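import Mathlib.Analysis.SpecialFunctions.Pow.Real
import Mathlib.Analysis.SpecialFunctions.Integrals.Basic
import Mathlib.MeasureTheory.Integral.IntervalIntegral.FundThmCalculus
import Mathlib.Analysis.Calculus.MeanValue
import Literature.Geometry.Lorentzian.Basic

/-!
# Route EIHFluxBalance — `InertialRecession`, line `old-light-leaves-the-cone`: charge kinematics, II
(the FLY-BY INTEGRAL)

Helper file for the crux `stmt-FinalStateConjecture-10166`, endgame stub `stub_expandingChargeKinematics`
(second line lead). The one estimate that turns "old relative velocity is frozen" into arithmetic: if a
scalar coordinate `φ` of a relative position moves MONOTONICALLY at rate `φ' ≥ g > 0` on `[a, b]`, then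
for every floor `m > 0` and exponent `p > 1`

`∫_a^b (max m |φ τ|)^{-p} dτ ≤ (2p / ((p − 1) g)) · m^{1−p}`,

uniformly in the length of `[a, b]` (substitute `x = φ(τ)`; the whole real line contributes
`∫ (max m |x|)^{-p} dx = 2p m^{1−p}/(p−1)`). With `p = 7/4` (and `p = 2`) this bounds the impulse a
window law `C∫(R⁻² + R^{-7/4})` can deliver during a passage at closest distance `≥ m` and relative
speed `≥ g`: `O(m^{-3/4}/g) → 0`. Mathlib only; [folklore].
-/

set_option linter.dupNamespace false

noncomputable section

open Filter Set Metric Real MeasureTheory intervalIntegral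
open scoped Topology

namespace Summit.FinalStateConjecture.FinalStateConjecture.Theorems.ChargeKinematics

/-- The fly-by kernel `h_m(x) = (max m |x|)^{-p}`. We do not introduce a definition; this lemma records
its continuity. [folklore] -/
theorem continuous_flyByKernel (m p : ℝ) (hm : 0 < m) :
    Continuous fun x : ℝ ↦ (max m |x|) ^ (-p) := by
  refine Continuous.rpow_const (continuous_const.max continuous_abs) fun x ↦ Or.inl ?_
  exact (hm.trans_le (le_max_left _ _)).ne'

/-- The kernel is positive. [folklore] -/
theorem flyByKernel_pos {m p : ℝ} (hm : 0 < m) (x : ℝ) : 0 < (max m |x|) ^ (-p) :=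
  Real.rpow_pos_of_pos (hm.trans_le (le_max_left _ _)) _

/-- The kernel is bounded by `m^{-p}`. [folklore] -/
theorem flyByKernel_le {m p : ℝ} (hm : 0 < m) (hp : 0 ≤ p) (x : ℝ) :
    (max m |x|) ^ (-p) ≤ m ^ (-p) := by
  rw [Real.rpow_neg hm.le, Real.rpow_neg (hm.le.trans (le_max_left _ _))]
  apply inv_anti₀ (Real.rpow_pos_of_pos hm _)
  exact Real.rpow_le_rpow hm.le (le_max_left _ _) hp

/-- The kernel is bounded by `|x|^{-p}` away from `0`. [folklore] -/
theorem flyByKernel_le_abs {m p : ℝ} (hm : 0 < m) (hp : 0 ≤ p) {x : ℝ} (hx : x ≠ 0) :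
    (max m |x|) ^ (-p) ≤ |x| ^ (-p) := by
  have hx' : 0 < |x| := abs_pos.mpr hx
  rw [Real.rpow_neg hx'.le, Real.rpow_neg (hm.le.trans (le_max_left _ _))]
  apply inv_anti₀ (Real.rpow_pos_of_pos hx' _)
  exact Real.rpow_le_rpow hx'.le (le_max_right _ _) hp

/-- Half-line mass of the kernel: for `0 ≤ X`, `∫_0^X (max m |x|)^{-p} ≤ p m^{1−p}/(p−1)`. [folklore] -/
theorem integral_flyByKernel_le_of_nonneg {m p X : ℝ} (hm : 0 < m) (hp : 1 < p) (hX : 0 ≤ X) :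
    ∫ x in (0 : ℝ)..X, (max m |x|) ^ (-p) ≤ p * m ^ (1 - p) / (p - 1) := by
  have hp0 : 0 ≤ p := by linarith
  have hcont := continuous_flyByKernel m p hm
  have hmp : 0 < m ^ (1 - p) := Real.rpow_pos_of_pos hm _
  -- split at `min X m`
  rcases le_or_gt X m with hXm | hXm
  · -- `X ≤ m`: integrand `≤ m^{-p}`, length `≤ m`
    calc ∫ x in (0 : ℝ)..X, (max m |x|) ^ (-p)
        ≤ ∫ x in (0 : ℝ)..X, m ^ (-p) :=
          intervalIntegral.integral_mono_on hX (hcont.intervalIntegrable _ _)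
            intervalIntegrable_const fun x _ ↦ flyByKernel_le hm hp0 x
      _ = X * m ^ (-p) := by simp
      _ ≤ m * m ^ (-p) := mul_le_mul_of_nonneg_right hXm (Real.rpow_nonneg hm.le _)
      _ = m ^ (1 - p) := by
          rw [sub_eq_add_neg, Real.rpow_add hm, Real.rpow_one]
      _ ≤ p * m ^ (1 - p) / (p - 1) := by
          rw [le_div_iff₀ (by linarith)]
          nlinarith
  · -- `m < X`: `[0, m]` contributes `≤ m^{1-p}`, `[m, X]` contributes `≤ m^{1-p}/(p-1)`
    have hsplit : ∫ x in (0 : ℝ)..X, (max m |x|) ^ (-p) =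
        (∫ x in (0 : ℝ)..m, (max m |x|) ^ (-p)) + ∫ x in m..X, (max m |x|) ^ (-p) :=
      (intervalIntegral.integral_add_adjacent_intervals (hcont.intervalIntegrable _ _)
        (hcont.intervalIntegrable _ _)).symm
    have h1 : ∫ x in (0 : ℝ)..m, (max m |x|) ^ (-p) ≤ m ^ (1 - p) := by
      calc ∫ x in (0 : ℝ)..m, (max m |x|) ^ (-p)
          ≤ ∫ x in (0 : ℝ)..m, m ^ (-p) :=
            intervalIntegral.integral_mono_on hm.le (hcont.intervalIntegrable _ _)
              intervalIntegrable_const fun x _ ↦ flyByKernel_le hm hp0 x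
        _ = m * m ^ (-p) := by simp
        _ = m ^ (1 - p) := by rw [sub_eq_add_neg, Real.rpow_add hm, Real.rpow_one]
    have h2 : ∫ x in m..X, (max m |x|) ^ (-p) ≤ m ^ (1 - p) / (p - 1) := by
      have h0 : (0 : ℝ) ∉ Set.uIcc m X := by
        rw [Set.uIcc_of_le hXm.le]; exact fun hx ↦ by linarith [hx.1]
      calc ∫ x in m..X, (max m |x|) ^ (-p)
          ≤ ∫ x in m..X, x ^ (-p) := by
            refine intervalIntegral.integral_mono_on hXm.le (hcont.intervalIntegrable _ _)
              (intervalIntegral.intervalIntegrable_rpow (Or.inr h0)) fun x hx ↦ ?_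
            have hx0 : 0 < x := hm.trans_le hx.1
            have := flyByKernel_le_abs hm hp0 hx0.ne' (m := m) (p := p)
            rw [abs_of_pos hx0] at this ⊢
            exact this
        _ = (X ^ (-p + 1) - m ^ (-p + 1)) / (-p + 1) := integral_rpow (Or.inr ⟨by linarith, h0⟩)
        _ ≤ m ^ (1 - p) / (p - 1) := by
            have hpm : -p + 1 = 1 - p := by ring
            rw [hpm]
            have hX1 : 0 ≤ X ^ (1 - p) := Real.rpow_nonneg (hm.le.trans hXm.le) _
            have h1p : (1 - p) ≠ 0 := by linarith
            have hp1 : (p - 1) ≠ 0 := by linarith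
            have key : (X ^ (1 - p) - m ^ (1 - p)) / (1 - p) =
                (m ^ (1 - p) - X ^ (1 - p)) / (p - 1) := by
              field_simp
              ring
            rw [key]
            exact div_le_div_of_nonneg_right (by linarith) (by linarith)
    rw [hsplit]
    have hp1 : (p - 1) ≠ 0 := by linarith
    have : m ^ (1 - p) + m ^ (1 - p) / (p - 1) = p * m ^ (1 - p) / (p - 1) := by
      field_simp
      ring
    linarith

/-- Whole-line antiderivative bound: `G(x) = ∫_0^x (max m |y|)^{-p}` satisfies `|G x| ≤ p m^{1−p}/(p−1)`
for every real `x`. [folklore] -/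
theorem abs_integral_flyByKernel_le {m p : ℝ} (hm : 0 < m) (hp : 1 < p) (x : ℝ) :
    |∫ y in (0 : ℝ)..x, (max m |y|) ^ (-p)| ≤ p * m ^ (1 - p) / (p - 1) := by
  have hcont := continuous_flyByKernel m p hm
  rcases le_or_gt 0 x with hx | hx
  · rw [abs_of_nonneg (intervalIntegral.integral_nonneg hx fun y _ ↦ (flyByKernel_pos hm y).le)]
    exact integral_flyByKernel_le_of_nonneg hm hp hx
  · -- reflect: the kernel is even
    have heven : ∫ y in (0 : ℝ)..x, (max m |y|) ^ (-p) = -∫ y in (0 : ℝ)..(-x), (max m |y|) ^ (-p) := by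
      have := intervalIntegral.integral_comp_neg (a := (0 : ℝ)) (b := -x)
        (f := fun y : ℝ ↦ (max m |y|) ^ (-p))
      simp only [abs_neg, neg_zero, neg_neg] at this
      rw [this, intervalIntegral.integral_symm (0 : ℝ) x, neg_neg]
    rw [heven, abs_neg,
      abs_of_nonneg (intervalIntegral.integral_nonneg (by linarith) fun y _ ↦ (flyByKernel_pos hm y).le)]
    exact integral_flyByKernel_le_of_nonneg hm hp (by linarith)

/-- **THE FLY-BY INTEGRAL.** If `φ` is `C¹` on a neighbourhood of `[a, b]` (we ask for `HasDerivAt`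
everywhere and a continuous derivative) with `φ' ≥ g > 0` on `[a, b]`, then for every floor `m > 0`
and exponent `p > 1`,
`∫_a^b (max m |φ τ|)^{-p} dτ ≤ 2p m^{1−p} / ((p − 1) g)`, uniformly in `b − a`. [folklore] -/
theorem flyBy_integral_le {φ φ' : ℝ → ℝ} {a b g m p : ℝ} (hab : a ≤ b) (hg : 0 < g) (hm : 0 < m)
    (hp : 1 < p) (hφ : ∀ τ, HasDerivAt φ (φ' τ) τ) (hφ' : Continuous φ')
    (hmono : ∀ τ ∈ Set.Icc a b, g ≤ φ' τ) :
    ∫ τ in a..b, (max m |φ τ|) ^ (-p) ≤ 2 * p * m ^ (1 - p) / ((p - 1) * g) := by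
  have hcont := continuous_flyByKernel m p hm
  -- the antiderivative `G` of the kernel and the chain rule for `G ∘ φ`
  set G : ℝ → ℝ := fun x ↦ ∫ y in (0 : ℝ)..x, (max m |y|) ^ (-p) with hG
  have hGd : ∀ x, HasDerivAt G ((max m |x|) ^ (-p)) x := fun x ↦
    hcont.integral_hasStrictDerivAt 0 x |>.hasDerivAt
  have hcomp : ∀ τ, HasDerivAt (fun τ ↦ G (φ τ)) ((max m |φ τ|) ^ (-p) * φ' τ) τ := fun τ ↦
    (hGd (φ τ)).comp τ (hφ τ)
  -- pointwise: kernel ≤ (kernel · φ') / g on `[a, b]`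
  have hpt : ∀ τ ∈ Set.Icc a b, (max m |φ τ|) ^ (-p) ≤ (max m |φ τ|) ^ (-p) * φ' τ / g := by
    intro τ hτ
    rw [le_div_iff₀ hg]
    exact mul_le_mul_of_nonneg_left (hmono τ hτ) (flyByKernel_pos hm _).le
  have hφc : Continuous φ := continuous_iff_continuousAt.mpr fun τ ↦ (hφ τ).continuousAt
  have hint1 : IntervalIntegrable (fun τ ↦ (max m |φ τ|) ^ (-p)) volume a b :=
    (hcont.comp hφc).intervalIntegrable _ _
  have hint2 : IntervalIntegrable (fun τ ↦ (max m |φ τ|) ^ (-p) * φ' τ / g) volume a b :=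
    (((hcont.comp hφc).mul hφ').div_const g).intervalIntegrable _ _
  calc ∫ τ in a..b, (max m |φ τ|) ^ (-p)
      ≤ ∫ τ in a..b, (max m |φ τ|) ^ (-p) * φ' τ / g :=
        intervalIntegral.integral_mono_on hab hint1 hint2 hpt
    _ = (∫ τ in a..b, (max m |φ τ|) ^ (-p) * φ' τ) / g := by
        rw [intervalIntegral.integral_div]
    _ = (G (φ b) - G (φ a)) / g := by
        rw [intervalIntegral.integral_eq_sub_of_hasDerivAt (fun τ _ ↦ hcomp τ)
          (((hcont.comp hφc).mul hφ').intervalIntegrable _ _)]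
    _ ≤ (2 * p * m ^ (1 - p) / (p - 1)) / g := by
        apply div_le_div_of_nonneg_right _ hg.le
        have h1 := abs_integral_flyByKernel_le hm hp (φ b)
        have h2 := abs_integral_flyByKernel_le hm hp (φ a)
        have := abs_sub (G (φ b)) (G (φ a))
        calc G (φ b) - G (φ a) ≤ |G (φ b) - G (φ a)| := le_abs_self _
          _ ≤ |G (φ b)| + |G (φ a)| := abs_sub _ _
          _ ≤ p * m ^ (1 - p) / (p - 1) + p * m ^ (1 - p) / (p - 1) := add_le_add h1 h2
          _ = 2 * p * m ^ (1 - p) / (p - 1) := by ring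
    _ = 2 * p * m ^ (1 - p) / ((p - 1) * g) := by rw [div_div]

end Summit.FinalStateConjecture.FinalStateConjecture.Theorems.ChargeKinematics

namespace Summit.FinalStateConjecture.FinalStateConjecture.Theorems

/-- REGISTERED STUB `flyBy_integral_le` of the crux item stmt-FinalStateConjecture-10166 (second line lead, line
`old-light-leaves-the-cone`, S4 helper series): the registered one-line signature verbatim, discharged by
`ChargeKinematics.flyBy_integral_le`. [folklore] -/
theorem flyBy_integral_le : open Literature.Geometry.Lorentzian Filter Topology MeasureTheory intervalIntegral in ∀ {φ φ' : ℝ → ℝ} {a b g m p : ℝ} (hab : a ≤ b) (hg : 0 < g) (hm : 0 < m) (hp : 1 < p) (hφ : ∀ τ, HasDerivAt φ (φ' τ) τ) (hφ' : Continuous φ') (hmono : ∀ τ ∈ Set.Icc a b, g ≤ φ' τ), ∫ τ in a..b, (max m |φ τ|) ^ (-p) ≤ 2 * p * m ^ (1 - p) / ((p - 1) * g) :=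
  @ChargeKinematics.flyBy_integral_le

end Summit.FinalStateConjecture.FinalStateConjecture.Theorems

end
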